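import Summits.Ventures.CertifiedManyBodySolver.Downfold.EmeryOrbitalWeightFaceDirBox
import Summits.Ventures.CertifiedManyBodySolver.Downfold.EmeryVanHoveSubBox
import Summits.Ventures.CertifiedManyBodySolver.Downfold.EmeryVanHoveTableB
import Summits.Ventures.CertifiedManyBodySolver.Downfold.EmeryVanHoveTableE
import Summits.Ventures.CertifiedManyBodySolver.Downfold.EmeryVanHoveTableF
import Summits.Ventures.CertifiedManyBodySolver.Downfold.EmeryFermiFaceDirPointsHg1223IPNH120S1
import Summits.Ventures.CertifiedManyBodySolver.Downfold.EmeryFermiFaceDirPointsHg1223IPNH120S2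
import Summits.Ventures.CertifiedManyBodySolver.Downfold.EmeryFermiFaceDirPointsHg1223IPNH120S3
import HarnessLib

/-!
# THE ANTINODAL FERMI-SURFACE Cu-d WEIGHT OVER THE TYPED 3BE BOX `emeryBoxHg1223IP (EmeryBoxesTrilayer)` AT FILLING n_H = 1.20 (ν = 2/5), regime-free rule v2 — the kinematic leg of the UPPER member
# `U_B∣full(w_antinode)` of the weak band-level `U` bracket read over a box where the v1 rule's antinodal charge-transfer regime FAILS at the low-Δ corners
# (INFL-3to1-B §B.90 (j); kernel `EmeryOrbitalWeightFaceDirBox`; router/EMERY-FS-WEIGHT-BRACKETS.tsv / OBJECT-E-BUDGET.tsv §C)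

Venture CertifiedManyBodySolver, cell `pub/hubbard-downfold` (stage S1), seat hubbard-downfold-mod-4 (technique B, g39); namespace
`Summit.Ventures.CertifiedManyBodySolver.Downfold.Emery`. Everything PROVED (0 sorry). WHAT THIS IS NOT: a statement about the material — the typed box (HgBa₂Ca₂Cu₃O₈ INNER plane (typed companion))
is SCREENING-GRADE; `U = 0` one-body kinematics of the σ model; the `U_B` arithmetic that consumes the window is DERIVED context on the MEAN-FIELD annex (R-B17).

For every member θ = (Δ, t_pd, t_pp, t_pp′) ∈ [1.23, 2.02] × [1.16, 1.44] × [0.6, 0.76] × [0.11, 0.22] eV at filling ν = 2/5, the Cu-d weight of the ANTINODAL Bloch state,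
`dWeightFace θ (fermiEnergyOf θ ν)`, lies in the window below. DEVICE (v2): `W(θ) = W(Δ/t_pd, 1, t_pp/t_pd, t_pp′/t_pd)` (scaling law); the t_pd range is cut into 3 slabs; on each
normalised slab the v2 CORNER RULE `dWeightFace_fermiEnergyOf_mem_Icc_of_mem_box3_dir_num`: Δ ↑ at fixed filling WITHOUT the regime (region-wide directional certificate
`faceDir_nonneg_of_mem_region`, κ₀ = 1/10, + the Fermi-energy slope law κ = 1/10 + mean value theorem), t_pp ↓, t_pp′ ↑ only at the upper corner (regime margin R2 there),
lower end `t_pp′`-decoupled (`dWeightFaceLoDec` at `E_h`); hole-likeness from the slab's `vhBoxCheck` + the Ψ table; two K = 384 Fermi-energy brackets per slab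
(`EmeryFermiFaceDirPointsHg1223IPNH120S<k>`). The slab corners are VIRTUAL (not members): the window is a sound ENCLOSURE (lower end ≈ 0.02 below the v1 virtual-corner value).

| t_pd slab (eV) | normalised slab Δ/t_pd × t_pp/t_pd × t_pp′/t_pd | q₁ (vhBoxCheck) ≥ table point | E_h | E_v | margins (R2, 1 − κ − w̄_axis) | **w_face window** |
|---|---|---|---|---|---|---|
| [1.16, 1.253] | [0.9814, 1.741] × [0.4787, 0.6552] × [0.08777, 0.1897] | 0.5310 ≥ 21/40 (Ψ ≤ 0.3899) | 1.5405 | 1.137 | +0.205, +0.136 | **[0.5819, 0.7562]** |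
| [1.253, 1.347] | [0.9134, 1.612] × [0.4455, 0.6064] × [0.08168, 0.1755] | 0.5035 ≥ 1/2 (Ψ ≤ 0.3931) | 1.5584 | 1.1781 | +0.305, +0.150 | **[0.5786, 0.7429]** |
| [1.347, 1.44] | [0.8542, 1.5] × [0.4167, 0.5644] × [0.07639, 0.1634] | 0.4780 ≥ 93/200 (Ψ ≤ 0.3977) | 1.5749 | 1.215 | +0.395, +0.164 | **[0.5755, 0.731]** |
| **whole box** | (hull of the slabs) | | | | | **[0.5755, 0.7562]** |

Sources: three-band model [HybertsenSchluterChristensen1989, Eq. (1)]; face point of the bilinear contour [AndersenEtAl1995, §6]; [folklore] algebra.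
-/

noncomputable section

namespace Summit.Ventures.CertifiedManyBodySolver.Downfold.Emery

open Real Set

/-- **Slab 1 (t_pd ∈ [1.16, 1.253] eV) of `emeryBoxHg1223IP (EmeryBoxesTrilayer)`, ν = 2/5: the antinodal Fermi-surface Cu-d weight of every member lies in `[0.5819, 0.7562]`**
(normalised-slab v2 corner rule; brackets `faceDirPt_Hg1223IP_nH120_s1_lo_br` / `_hi_br`). [folklore] -/
theorem hg1223IPBox_dWeightFaceDir_nH120_s1 {Δ a b c : ℝ} (hΔ : Δ ∈ Icc ((123 : ℝ) / 100) ((101 : ℝ) / 50)) (ha : a ∈ Icc ((29 : ℝ) / 25) ((94 : ℝ) / 75)) (hb : b ∈ Icc ((3 : ℝ) / 5) ((19 : ℝ) / 25)) (hc : c ∈ Icc ((11 : ℝ) / 100) ((11 : ℝ) / 50)) :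
    dWeightFace Δ a b c (fermiEnergyOf Δ a b c ((2 : ℝ) / 5)) ∈ Icc ((5819 : ℝ) / 10000) ((3781 : ℝ) / 5000) := by
  have ha0 : 0 < a := lt_of_lt_of_le (by norm_num) ha.1
  rw [dWeightFace_fermiEnergyOf_eq_ratios ha0]
  have hΔn : Δ / a ∈ Icc ((369 : ℝ) / 376) ((101 : ℝ) / 58) := by
    constructor
    · rw [le_div_iff₀ ha0]; linarith [hΔ.1, ha.2]
    · rw [div_le_iff₀ ha0]; linarith [hΔ.2, ha.1]
  have hbn : b / a ∈ Icc ((45 : ℝ) / 94) ((19 : ℝ) / 29) := by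
    constructor
    · rw [le_div_iff₀ ha0]; linarith [hb.1, ha.2]
    · rw [div_le_iff₀ ha0]; linarith [hb.2, ha.1]
  have hcn : c / a ∈ Icc ((33 : ℝ) / 376) ((11 : ℝ) / 58) := by
    constructor
    · rw [le_div_iff₀ ha0]; linarith [hc.1, ha.2]
    · rw [div_le_iff₀ ha0]; linarith [hc.2, ha.1]
  have hVH : ∀ Δ' b' c' : ℝ, Δ' ∈ Icc ((369 : ℝ) / 376) ((101 : ℝ) / 58) → b' ∈ Icc ((45 : ℝ) / 94) ((19 : ℝ) / 29) → c' ∈ Icc ((33 : ℝ) / 376) ((11 : ℝ) / 58) →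
      1 - 2 * ((2 : ℝ) / 5) ≤ xVH Δ' 1 b' c' := by
    intro Δ' b' c' hΔ' hb' hc'
    have h := xVH_window_of_vhBoxCheck (Δ₁ := ((369 : ℚ) / 376)) (Δ₂ := ((101 : ℚ) / 58)) (a₁ := (1 : ℚ)) (a₂ := (1 : ℚ)) (b₁ := ((45 : ℚ) / 94)) (b₂ := ((19 : ℚ) / 29))
      (c₁ := ((33 : ℚ) / 376)) (c₂ := ((11 : ℚ) / 58)) (v₁ := ((2771 : ℚ) / 2500)) (v₂ := ((14419 : ℚ) / 10000)) (e := ((1311 : ℚ) / 1000)) (E := ((12109 : ℚ) / 10000))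
      (q₁ := ((531 : ℚ) / 1000)) (q₂ := ((3201 : ℚ) / 2500)) (by decide +kernel)
      (Δ := Δ') (tpd := 1) (tpp := b') (c := c') (by simpa using hΔ') (by simp) (by simpa using hb') (by simpa using hc')
    obtain ⟨-, -, -, -, -, hwin⟩ := h
    push_cast at hwin
    have ht := vhFrac_21_40
    have hmono := vhFrac_anti (show (21 / 40 : ℝ) ≤ ((531 : ℝ) / 1000) by norm_num)
    have hnu : ((57496 : ℝ) / 147456) ≤ ((2 : ℝ) / 5) := by norm_num
    linarith [hwin.1, ht.2]
  have hEh := (fermiEnergyOf_of_pointBracketCheck faceDirPt_Hg1223IP_nH120_s1_lo_br (by norm_num) (by norm_num) (by norm_num) (ν := (2/5 : ℝ))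
    (by push_cast; exact ⟨le_rfl, le_rfl⟩)).2
  have hEv := (fermiEnergyOf_of_pointBracketCheck faceDirPt_Hg1223IP_nH120_s1_hi_br (by norm_num) (by norm_num) (by norm_num) (ν := (2/5 : ℝ))
    (by push_cast; exact ⟨le_rfl, le_rfl⟩)).2
  push_cast at hEh hEv
  refine dWeightFace_fermiEnergyOf_mem_Icc_of_mem_box3_dir_num (Eh := ((3081 : ℝ) / 2000)) (Ev := ((1137 : ℝ) / 1000)) (Elow := ((1127 : ℝ) / 1000)) (κ₀ := 1 / 10) (κ := 1 / 10)
    (by norm_num) one_pos (by norm_num) (by norm_num) (by norm_num) hΔn hbn hcn (by norm_num) (by norm_num) hVH hEh.2 (by norm_num)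
    (by norm_num [faceU, fsD, fsN, cA]) (by norm_num [faceU, fsD, fsN, cA]) (by norm_num [faceU, fsD, fsN, cA]) (by norm_num [faceU, fsD, fsN, cA])
    hEv.1 (by norm_num) (by norm_num) (by norm_num [faceG]) (by norm_num) (by norm_num) (by norm_num) le_rfl (by norm_num [dWeightAxisCF])
    (by norm_num) (by norm_num) ?_ (by norm_num [dWeightFaceLoDec, faceRUp, faceN]) (by norm_num [dWeightFaceCF, faceN, faceR, fsN])
  intro D B C e hD hB hC he hG
  exact faceDir_nonneg_of_mem_region ⟨le_trans (by norm_num) hD.1, le_trans hD.2 (by norm_num)⟩ ⟨le_trans (by norm_num) he.1, le_trans he.2 (by norm_num)⟩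
    ⟨le_trans (by norm_num) hB.1, le_trans hB.2 (by norm_num)⟩ ⟨le_trans (by norm_num) hC.1, le_trans hC.2 (by norm_num)⟩ hG

/-- **Slab 2 (t_pd ∈ [1.253, 1.347] eV) of `emeryBoxHg1223IP (EmeryBoxesTrilayer)`, ν = 2/5: the antinodal Fermi-surface Cu-d weight of every member lies in `[0.5786, 0.7429]`**
(normalised-slab v2 corner rule; brackets `faceDirPt_Hg1223IP_nH120_s2_lo_br` / `_hi_br`). [folklore] -/
theorem hg1223IPBox_dWeightFaceDir_nH120_s2 {Δ a b c : ℝ} (hΔ : Δ ∈ Icc ((123 : ℝ) / 100) ((101 : ℝ) / 50)) (ha : a ∈ Icc ((94 : ℝ) / 75) ((101 : ℝ) / 75)) (hb : b ∈ Icc ((3 : ℝ) / 5) ((19 : ℝ) / 25)) (hc : c ∈ Icc ((11 : ℝ) / 100) ((11 : ℝ) / 50)) :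
    dWeightFace Δ a b c (fermiEnergyOf Δ a b c ((2 : ℝ) / 5)) ∈ Icc ((2893 : ℝ) / 5000) ((7429 : ℝ) / 10000) := by
  have ha0 : 0 < a := lt_of_lt_of_le (by norm_num) ha.1
  rw [dWeightFace_fermiEnergyOf_eq_ratios ha0]
  have hΔn : Δ / a ∈ Icc ((369 : ℝ) / 404) ((303 : ℝ) / 188) := by
    constructor
    · rw [le_div_iff₀ ha0]; linarith [hΔ.1, ha.2]
    · rw [div_le_iff₀ ha0]; linarith [hΔ.2, ha.1]
  have hbn : b / a ∈ Icc ((45 : ℝ) / 101) ((57 : ℝ) / 94) := by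
    constructor
    · rw [le_div_iff₀ ha0]; linarith [hb.1, ha.2]
    · rw [div_le_iff₀ ha0]; linarith [hb.2, ha.1]
  have hcn : c / a ∈ Icc ((33 : ℝ) / 404) ((33 : ℝ) / 188) := by
    constructor
    · rw [le_div_iff₀ ha0]; linarith [hc.1, ha.2]
    · rw [div_le_iff₀ ha0]; linarith [hc.2, ha.1]
  have hVH : ∀ Δ' b' c' : ℝ, Δ' ∈ Icc ((369 : ℝ) / 404) ((303 : ℝ) / 188) → b' ∈ Icc ((45 : ℝ) / 101) ((57 : ℝ) / 94) → c' ∈ Icc ((33 : ℝ) / 404) ((33 : ℝ) / 188) →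
      1 - 2 * ((2 : ℝ) / 5) ≤ xVH Δ' 1 b' c' := by
    intro Δ' b' c' hΔ' hb' hc'
    have h := xVH_window_of_vhBoxCheck (Δ₁ := ((369 : ℚ) / 404)) (Δ₂ := ((303 : ℚ) / 188)) (a₁ := (1 : ℚ)) (a₂ := (1 : ℚ)) (b₁ := ((45 : ℚ) / 101)) (b₂ := ((57 : ℚ) / 94))
      (c₁ := ((33 : ℚ) / 404)) (c₂ := ((33 : ℚ) / 188)) (v₁ := ((2307 : ℚ) / 2000)) (v₂ := ((14739 : ℚ) / 10000)) (e := ((3373 : ℚ) / 2500)) (E := ((12533 : ℚ) / 10000))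
      (q₁ := ((1007 : ℚ) / 2000)) (q₂ := ((11689 : ℚ) / 10000)) (by decide +kernel)
      (Δ := Δ') (tpd := 1) (tpp := b') (c := c') (by simpa using hΔ') (by simp) (by simpa using hb') (by simpa using hc')
    obtain ⟨-, -, -, -, -, hwin⟩ := h
    push_cast at hwin
    have ht := vhFrac_1_2
    have hmono := vhFrac_anti (show (1 / 2 : ℝ) ≤ ((1007 : ℝ) / 2000) by norm_num)
    have hnu : ((57961 : ℝ) / 147456) ≤ ((2 : ℝ) / 5) := by norm_num
    linarith [hwin.1, ht.2]
  have hEh := (fermiEnergyOf_of_pointBracketCheck faceDirPt_Hg1223IP_nH120_s2_lo_br (by norm_num) (by norm_num) (by norm_num) (ν := (2/5 : ℝ))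
    (by push_cast; exact ⟨le_rfl, le_rfl⟩)).2
  have hEv := (fermiEnergyOf_of_pointBracketCheck faceDirPt_Hg1223IP_nH120_s2_hi_br (by norm_num) (by norm_num) (by norm_num) (ν := (2/5 : ℝ))
    (by push_cast; exact ⟨le_rfl, le_rfl⟩)).2
  push_cast at hEh hEv
  refine dWeightFace_fermiEnergyOf_mem_Icc_of_mem_box3_dir_num (Eh := ((974 : ℝ) / 625)) (Ev := ((11781 : ℝ) / 10000)) (Elow := ((11681 : ℝ) / 10000)) (κ₀ := 1 / 10) (κ := 1 / 10)
    (by norm_num) one_pos (by norm_num) (by norm_num) (by norm_num) hΔn hbn hcn (by norm_num) (by norm_num) hVH hEh.2 (by norm_num)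
    (by norm_num [faceU, fsD, fsN, cA]) (by norm_num [faceU, fsD, fsN, cA]) (by norm_num [faceU, fsD, fsN, cA]) (by norm_num [faceU, fsD, fsN, cA])
    hEv.1 (by norm_num) (by norm_num) (by norm_num [faceG]) (by norm_num) (by norm_num) (by norm_num) le_rfl (by norm_num [dWeightAxisCF])
    (by norm_num) (by norm_num) ?_ (by norm_num [dWeightFaceLoDec, faceRUp, faceN]) (by norm_num [dWeightFaceCF, faceN, faceR, fsN])
  intro D B C e hD hB hC he hG
  exact faceDir_nonneg_of_mem_region ⟨le_trans (by norm_num) hD.1, le_trans hD.2 (by norm_num)⟩ ⟨le_trans (by norm_num) he.1, le_trans he.2 (by norm_num)⟩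
    ⟨le_trans (by norm_num) hB.1, le_trans hB.2 (by norm_num)⟩ ⟨le_trans (by norm_num) hC.1, le_trans hC.2 (by norm_num)⟩ hG

/-- **Slab 3 (t_pd ∈ [1.347, 1.44] eV) of `emeryBoxHg1223IP (EmeryBoxesTrilayer)`, ν = 2/5: the antinodal Fermi-surface Cu-d weight of every member lies in `[0.5755, 0.731]`**
(normalised-slab v2 corner rule; brackets `faceDirPt_Hg1223IP_nH120_s3_lo_br` / `_hi_br`). [folklore] -/
theorem hg1223IPBox_dWeightFaceDir_nH120_s3 {Δ a b c : ℝ} (hΔ : Δ ∈ Icc ((123 : ℝ) / 100) ((101 : ℝ) / 50)) (ha : a ∈ Icc ((101 : ℝ) / 75) ((36 : ℝ) / 25)) (hb : b ∈ Icc ((3 : ℝ) / 5) ((19 : ℝ) / 25)) (hc : c ∈ Icc ((11 : ℝ) / 100) ((11 : ℝ) / 50)) :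
    dWeightFace Δ a b c (fermiEnergyOf Δ a b c ((2 : ℝ) / 5)) ∈ Icc ((1151 : ℝ) / 2000) ((731 : ℝ) / 1000) := by
  have ha0 : 0 < a := lt_of_lt_of_le (by norm_num) ha.1
  rw [dWeightFace_fermiEnergyOf_eq_ratios ha0]
  have hΔn : Δ / a ∈ Icc ((41 : ℝ) / 48) ((3 : ℝ) / 2) := by
    constructor
    · rw [le_div_iff₀ ha0]; linarith [hΔ.1, ha.2]
    · rw [div_le_iff₀ ha0]; linarith [hΔ.2, ha.1]
  have hbn : b / a ∈ Icc ((5 : ℝ) / 12) ((57 : ℝ) / 101) := by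
    constructor
    · rw [le_div_iff₀ ha0]; linarith [hb.1, ha.2]
    · rw [div_le_iff₀ ha0]; linarith [hb.2, ha.1]
  have hcn : c / a ∈ Icc ((11 : ℝ) / 144) ((33 : ℝ) / 202) := by
    constructor
    · rw [le_div_iff₀ ha0]; linarith [hc.1, ha.2]
    · rw [div_le_iff₀ ha0]; linarith [hc.2, ha.1]
  have hVH : ∀ Δ' b' c' : ℝ, Δ' ∈ Icc ((41 : ℝ) / 48) ((3 : ℝ) / 2) → b' ∈ Icc ((5 : ℝ) / 12) ((57 : ℝ) / 101) → c' ∈ Icc ((11 : ℝ) / 144) ((33 : ℝ) / 202) →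
      1 - 2 * ((2 : ℝ) / 5) ≤ xVH Δ' 1 b' c' := by
    intro Δ' b' c' hΔ' hb' hc'
    have h := xVH_window_of_vhBoxCheck (Δ₁ := ((41 : ℚ) / 48)) (Δ₂ := ((3 : ℚ) / 2)) (a₁ := (1 : ℚ)) (a₂ := (1 : ℚ)) (b₁ := ((5 : ℚ) / 12)) (b₂ := ((57 : ℚ) / 101))
      (c₁ := ((11 : ℚ) / 144)) (c₂ := ((33 : ℚ) / 202)) (v₁ := ((5973 : ℚ) / 5000)) (v₂ := ((7513 : ℚ) / 5000)) (e := ((2767 : ℚ) / 2000)) (E := ((3229 : ℚ) / 2500))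
      (q₁ := ((239 : ℚ) / 500)) (q₂ := ((2147 : ℚ) / 2000)) (by decide +kernel)
      (Δ := Δ') (tpd := 1) (tpp := b') (c := c') (by simpa using hΔ') (by simp) (by simpa using hb') (by simpa using hc')
    obtain ⟨-, -, -, -, -, hwin⟩ := h
    push_cast at hwin
    have ht := vhFrac_93_200
    have hmono := vhFrac_anti (show (93 / 200 : ℝ) ≤ ((239 : ℝ) / 500) by norm_num)
    have hnu : ((58647 : ℝ) / 147456) ≤ ((2 : ℝ) / 5) := by norm_num
    linarith [hwin.1, ht.2]
  have hEh := (fermiEnergyOf_of_pointBracketCheck faceDirPt_Hg1223IP_nH120_s3_lo_br (by norm_num) (by norm_num) (by norm_num) (ν := (2/5 : ℝ))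
    (by push_cast; exact ⟨le_rfl, le_rfl⟩)).2
  have hEv := (fermiEnergyOf_of_pointBracketCheck faceDirPt_Hg1223IP_nH120_s3_hi_br (by norm_num) (by norm_num) (by norm_num) (ν := (2/5 : ℝ))
    (by push_cast; exact ⟨le_rfl, le_rfl⟩)).2
  push_cast at hEh hEv
  refine dWeightFace_fermiEnergyOf_mem_Icc_of_mem_box3_dir_num (Eh := ((15749 : ℝ) / 10000)) (Ev := ((243 : ℝ) / 200)) (Elow := ((241 : ℝ) / 200)) (κ₀ := 1 / 10) (κ := 1 / 10)
    (by norm_num) one_pos (by norm_num) (by norm_num) (by norm_num) hΔn hbn hcn (by norm_num) (by norm_num) hVH hEh.2 (by norm_num)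
    (by norm_num [faceU, fsD, fsN, cA]) (by norm_num [faceU, fsD, fsN, cA]) (by norm_num [faceU, fsD, fsN, cA]) (by norm_num [faceU, fsD, fsN, cA])
    hEv.1 (by norm_num) (by norm_num) (by norm_num [faceG]) (by norm_num) (by norm_num) (by norm_num) le_rfl (by norm_num [dWeightAxisCF])
    (by norm_num) (by norm_num) ?_ (by norm_num [dWeightFaceLoDec, faceRUp, faceN]) (by norm_num [dWeightFaceCF, faceN, faceR, fsN])
  intro D B C e hD hB hC he hG
  exact faceDir_nonneg_of_mem_region ⟨le_trans (by norm_num) hD.1, le_trans hD.2 (by norm_num)⟩ ⟨le_trans (by norm_num) he.1, le_trans he.2 (by norm_num)⟩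
    ⟨le_trans (by norm_num) hB.1, le_trans hB.2 (by norm_num)⟩ ⟨le_trans (by norm_num) hC.1, le_trans hC.2 (by norm_num)⟩ hG

/-- **`emeryBoxHg1223IP (EmeryBoxesTrilayer)`, ν = 2/5: for EVERY member θ the Cu-d weight of the antinodal Fermi-surface state lies in `[0.5755, 0.7562]`** (hull of the 3 t_pd slab windows; regime-free rule v2). [folklore] -/
theorem hg1223IPBox_dWeightFaceDir_nH120 {Δ a b c : ℝ} (hΔ : Δ ∈ Icc ((123 : ℝ) / 100) ((101 : ℝ) / 50)) (ha : a ∈ Icc ((29 : ℝ) / 25) ((36 : ℝ) / 25)) (hb : b ∈ Icc ((3 : ℝ) / 5) ((19 : ℝ) / 25)) (hc : c ∈ Icc ((11 : ℝ) / 100) ((11 : ℝ) / 50)) :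
    dWeightFace Δ a b c (fermiEnergyOf Δ a b c ((2 : ℝ) / 5)) ∈ Icc ((1151 : ℝ) / 2000) ((3781 : ℝ) / 5000) := by
  rcases le_or_gt a ((94 : ℝ) / 75) with h1 | h1
  · have h := hg1223IPBox_dWeightFaceDir_nH120_s1 hΔ ⟨ha.1, h1⟩ hb hc
    exact ⟨le_trans (by norm_num) h.1, le_trans h.2 (by norm_num)⟩
  · rcases le_or_gt a ((101 : ℝ) / 75) with h2 | h2
    · have h := hg1223IPBox_dWeightFaceDir_nH120_s2 hΔ ⟨h1.le, h2⟩ hb hc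
      exact ⟨le_trans (by norm_num) h.1, le_trans h.2 (by norm_num)⟩
    · have h := hg1223IPBox_dWeightFaceDir_nH120_s3 hΔ ⟨h2.le, ha.2⟩ hb hc
      exact ⟨le_trans (by norm_num) h.1, le_trans h.2 (by norm_num)⟩

end Summit.Ventures.CertifiedManyBodySolver.Downfold.Emery
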